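import Mathlib

/-!
# The inflated MOR returns `U_{p,k} ⊂ M_{pk}(ℂ)` for GENERAL `p ≥ 3` — the fat summand of the ratio knapsack `E(n) = U_{p,k} ⊕ B_{⌊√n⌋}(𝔫_d)`
# that kills line α's law C⁺ `UniformWeightLaw` on paper (Negative lane of crux `DualUnipotentThreeHalves`, supports stmt-ValiantsHypothesis-24318)

val-port-2 g3 (24318 line α `krylov_seed` LEAD; the line is DEAD ON PAPER — director-valiant R302/R304, critic of record val-idea-crit-7 g2 VERDICT V19 +
annex `Cruxes/DualUnipotentThreeHalves/CRITIC-V19-UniformWeightLaw-dead.md` @a92a18731268, witness val-idea-30 g3 `Ideas/ratio-knapsack.md`; dead file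
`Cruxes/DualUnipotentThreeHalves/Lines/krylov_seed_dead.md` @06379e82cda3).  This is hand (ii)(a) of R304: the CONSTRUCTIBLE HALF of the kernel kill —
the space `U_{p,k}` for every `p` (✓ p667267 `Negative/InflatedReturns` is `p = 4`), with the two facts the knapsack uses:

On `ι p k = Fin p × Fin k`:  `U_{p,k} := { J_p ⊗ A + s·(R_p ⊗ 1_k) : A ∈ M_k(ℂ), s ∈ ℂ }`, `J_p = Σ_s E_{s,s+1}`, `R_p = E_{p−2,0} − E_{p−1,1}` (0-indexed).
* ★ `infl_pow_eq_zero` — **NILPOTENT, index `≤ p`, for EVERY `p ≥ 3`, every `A`, `s`** — by the TWO-RETURN CANCELLATION on block vectors: with `X = J_p⊗A + sR_p⊗1`,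
  `X(e₁⊗x) = e₀⊗Ax − s·e_{p−1}⊗x` and `X(e₀⊗Ax) = s·e_{p−2}⊗Ax = s·X(e_{p−1}⊗x)`, so `X²(e₁⊗x) = 0`; hence `X^{a+1}(e_a⊗x) = 0` for `a ≥ 1` and
  `X^p(e₀⊗x) = s·X^{p−1}(e_{p−2}⊗x) = 0` (no trace count, no parity; the annex's §1 «closed walks» argument made elementary);
  `inflSpace_nilpotent`.
* `inflSpace_irreducible` — **IRREDUCIBLE on `ℂ^p ⊗ ℂ^k`** for every `p ≥ 3`, `k ≥ 1` (shift down with `J⊗1` to reach `e₀ ⊗ w`, return with `R⊗1`, move with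
  `J⊗A`; ✓ p667267's proof with `4 ↦ p`).
* `finrank_inflSpace` — `dim U_{p,k} = k² + 1` (`p ≥ 3`, `k ≥ 1`).
The heavy-top ingredient (the non-unital algebra of `U_{p,k}` is `M_{pk}`) and the U-block level-function lemmas (annex §4 (U1)/(U2)) are the next files of this
lane.  Honest framing: plain linear algebra about one explicit family; nothing here is a `¬`-theorem yet, nothing touches R2 `HeavyTopLaw` / 24318 / 8062, and
`VP ≠ VNP` is NOT proved.  No definitions of record, no named facts (the `def`s are the witness's own data). [MOR 1991 §5; val-idea-30 g3; crit-7 g2 V19]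
-/

set_option linter.dupNamespace false
set_option autoImplicit false

open Matrix
open scoped Kronecker BigOperators

namespace Summit.ValiantsHypothesis.ValiantsHypothesis.Theorems.DualUnipotentThreeHalvesNegative.InflatedReturnsGeneral

/-! ## §1 The `p × p` letters -/

variable (p : ℕ)

/-- `J_p = Σ_s E_{s,s+1}` (the principal nilpotent Jordan block, superdiagonal). -/
def Jp : Matrix (Fin p) (Fin p) ℂ := fun i j => if (j : ℕ) = i + 1 then 1 else 0

/-- `R_p = E_{p−2,0} − E_{p−1,1}` (the two MOR returns; `p = 4`: `E₂₀ − E₃₁` = ✓ `InflatedReturns.R2`). -/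
def Rp : Matrix (Fin p) (Fin p) ℂ := fun i j =>
  if (i : ℕ) + 2 = p ∧ (j : ℕ) = 0 then 1 else if (i : ℕ) + 1 = p ∧ (j : ℕ) = 1 then -1 else 0

/-! ## §2 The inflation on `ι p k = Fin p × Fin k` -/

variable (k : ℕ)

/-- The index type `Fin p × Fin k` of `ℂ^p ⊗ ℂ^k`. -/
abbrev ι : Type := Fin p × Fin k

/-- `infl p k A s = J_p ⊗ A + s·(R_p ⊗ 1)`. -/
def infl (A : Matrix (Fin k) (Fin k) ℂ) (s : ℂ) : Matrix (ι p k) (ι p k) ℂ :=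
  Jp p ⊗ₖ A + s • (Rp p ⊗ₖ (1 : Matrix (Fin k) (Fin k) ℂ))

/-- The inflation as a linear map `M_k × ℂ → M_{pk}`. -/
def inflLin : (Matrix (Fin k) (Fin k) ℂ × ℂ) →ₗ[ℂ] Matrix (ι p k) (ι p k) ℂ where
  toFun q := infl p k q.1 q.2
  map_add' q q' := by
    simp only [infl, Prod.fst_add, Prod.snd_add, Matrix.kronecker_add, add_smul]; abel
  map_smul' c q := by
    simp only [infl, Prod.smul_fst, Prod.smul_snd, Matrix.kronecker_smul, smul_eq_mul, RingHom.id_apply, smul_add,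
      mul_smul]

/-- `U_{p,k}` as a submodule of `M_{pk}(ℂ)`. -/
def inflSpace : Submodule ℂ (Matrix (ι p k) (ι p k) ℂ) := LinearMap.range (inflLin p k)

/-- Membership in `U_{p,k}`. -/
lemma mem_inflSpace {X : Matrix (ι p k) (ι p k) ℂ} : X ∈ inflSpace p k ↔ ∃ A s, X = infl p k A s :=
  ⟨fun ⟨q, hq⟩ => ⟨q.1, q.2, hq.symm⟩, fun ⟨A, s, h⟩ => ⟨(A, s), h.symm⟩⟩

/-- Inflated matrices lie in `U_{p,k}`. -/
lemma infl_mem (A : Matrix (Fin k) (Fin k) ℂ) (s : ℂ) : infl p k A s ∈ inflSpace p k :=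
  (mem_inflSpace p k).2 ⟨A, s, rfl⟩

/-- `J_p ⊗ A ∈ U_{p,k}`. -/
lemma JA_mem (A : Matrix (Fin k) (Fin k) ℂ) : Jp p ⊗ₖ A ∈ inflSpace p k := by
  have : infl p k A 0 = Jp p ⊗ₖ A := by simp [infl]
  rw [← this]; exact infl_mem p k A 0

/-- `R_p ⊗ 1 ∈ U_{p,k}`. -/
lemma R1_mem : Rp p ⊗ₖ (1 : Matrix (Fin k) (Fin k) ℂ) ∈ inflSpace p k := by
  have : infl p k 0 1 = Rp p ⊗ₖ (1 : Matrix (Fin k) (Fin k) ℂ) := by simp [infl]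
  rw [← this]; exact infl_mem p k 0 1

/-! ## §3 Block vectors and the action of the letters -/

/-- `bv a x = e_a ⊗ x`. -/
def bv (a : Fin p) (x : Fin k → ℂ) : ι p k → ℂ := fun q => if q.1 = a then x q.2 else 0

/-- `e_a ⊗ 0 = 0`. -/
@[simp] lemma bv_zero (a : Fin p) : bv p k a 0 = 0 := by
  ext q; simp [bv]

/-- Action of a Kronecker product on a block vector. -/
lemma kron_mulVec_bv (M : Matrix (Fin p) (Fin p) ℂ) (N : Matrix (Fin k) (Fin k) ℂ) (a : Fin p) (x : Fin k → ℂ) :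
    (M ⊗ₖ N) *ᵥ bv p k a x = fun q => M q.1 a * (N *ᵥ x) q.2 := by
  ext ⟨b, i⟩
  simp only [Matrix.mulVec, dotProduct, bv, Matrix.kroneckerMap_apply, Fintype.sum_prod_type, mul_ite, mul_zero]
  rw [Finset.sum_eq_single a]
  · simp only [if_true, Finset.mul_sum, mul_assoc]
  · intro c _ hc; simp [hc]
  · intro h; exact absurd (Finset.mem_univ a) h

/-- `(J_p ⊗ A)(e_a ⊗ x) = e_b ⊗ Ax` for `b + 1 = a` (explicit target block `b`). -/
lemma JA_bv_succ (A : Matrix (Fin k) (Fin k) ℂ) (a b : Fin p) (hb : (b : ℕ) + 1 = a) (x : Fin k → ℂ) :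
    (Jp p ⊗ₖ A) *ᵥ bv p k a x = bv p k b (A *ᵥ x) := by
  rw [kron_mulVec_bv]
  ext ⟨b', i⟩
  simp only [Jp, bv]
  by_cases h : (a : ℕ) = b' + 1
  · have hb' : b' = b := Fin.ext (by omega)
    rw [if_pos h, if_pos hb', one_mul]
  · have hb' : b' ≠ b := fun e => h (by rw [e]; omega)
    rw [if_neg h, if_neg hb', zero_mul]

/-- `(J_p ⊗ A)(e_0 ⊗ x) = 0`. -/
lemma JA_bv_zero (A : Matrix (Fin k) (Fin k) ℂ) (a : Fin p) (ha : (a : ℕ) = 0) (x : Fin k → ℂ) :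
    (Jp p ⊗ₖ A) *ᵥ bv p k a x = 0 := by
  rw [kron_mulVec_bv]
  ext ⟨b, i⟩
  have h : ¬ ((a : ℕ) = b + 1) := by omega
  simp [Jp, h]

/-- `(R_p ⊗ 1)(e_0 ⊗ x) = e_b ⊗ x` for `b + 2 = p`. -/
lemma R1_bv_zero (a b : Fin p) (ha : (a : ℕ) = 0) (hb : (b : ℕ) + 2 = p) (x : Fin k → ℂ) :
    (Rp p ⊗ₖ (1 : Matrix (Fin k) (Fin k) ℂ)) *ᵥ bv p k a x = bv p k b x := by
  rw [kron_mulVec_bv]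
  ext ⟨b', i⟩
  simp only [Rp, bv, Matrix.one_mulVec]
  by_cases h : (b' : ℕ) + 2 = p
  · have hb' : b' = b := Fin.ext (by omega)
    rw [if_pos ⟨h, ha⟩, if_pos hb', one_mul]
  · have hb' : b' ≠ b := fun e => h (by rw [e]; omega)
    have h1 : ¬ ((b' : ℕ) + 2 = p ∧ (a : ℕ) = 0) := fun h' => h h'.1
    have h2 : ¬ ((b' : ℕ) + 1 = p ∧ (a : ℕ) = 1) := by omega
    rw [if_neg h1, if_neg h2, if_neg hb', zero_mul]

/-- `(R_p ⊗ 1)(e_1 ⊗ x) = −e_b ⊗ x` for `b + 1 = p`. -/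
lemma R1_bv_one (a b : Fin p) (ha : (a : ℕ) = 1) (hb : (b : ℕ) + 1 = p) (x : Fin k → ℂ) :
    (Rp p ⊗ₖ (1 : Matrix (Fin k) (Fin k) ℂ)) *ᵥ bv p k a x = -bv p k b x := by
  rw [kron_mulVec_bv]
  ext ⟨b', i⟩
  simp only [Rp, bv, Matrix.one_mulVec, Pi.neg_apply]
  have h1 : ¬ ((b' : ℕ) + 2 = p ∧ (a : ℕ) = 0) := by omega
  rw [if_neg h1]
  by_cases h : (b' : ℕ) + 1 = p
  · have hb' : b' = b := Fin.ext (by omega)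
    rw [if_pos ⟨h, ha⟩, if_pos hb', neg_one_mul]
  · have hb' : b' ≠ b := fun e => h (by rw [e]; omega)
    have h2 : ¬ ((b' : ℕ) + 1 = p ∧ (a : ℕ) = 1) := fun h' => h h'.1
    rw [if_neg h2, if_neg hb', zero_mul, neg_zero]

/-- `(R_p ⊗ 1)(e_a ⊗ x) = 0` for `a ≥ 2`. -/
lemma R1_bv_two (a : Fin p) (ha : 2 ≤ (a : ℕ)) (x : Fin k → ℂ) :
    (Rp p ⊗ₖ (1 : Matrix (Fin k) (Fin k) ℂ)) *ᵥ bv p k a x = 0 := by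
  rw [kron_mulVec_bv]
  ext ⟨b, i⟩
  have h1 : ¬ ((b : ℕ) + 2 = p ∧ (a : ℕ) = 0) := by omega
  have h2 : ¬ ((b : ℕ) + 1 = p ∧ (a : ℕ) = 1) := by omega
  simp [Rp, h1, h2]

/-! ## §4 Nilpotency by the two-return cancellation -/

variable {p k}

/-- `X(e_a ⊗ x) = e_b ⊗ Ax` for `a = b + 1 ≥ 2`. -/
lemma infl_mulVec_bv_two (A : Matrix (Fin k) (Fin k) ℂ) (s : ℂ) (a b : Fin p) (ha : 2 ≤ (a : ℕ)) (hb : (b : ℕ) + 1 = a)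
    (x : Fin k → ℂ) : infl p k A s *ᵥ bv p k a x = bv p k b (A *ᵥ x) := by
  rw [infl, Matrix.add_mulVec, Matrix.smul_mulVec, JA_bv_succ p k A a b hb, R1_bv_two p k a ha, smul_zero, add_zero]

/-- `X(e_1 ⊗ x) = e_0 ⊗ Ax − s·e_{p−1} ⊗ x` (blocks `z = 0`, `l = p − 1` explicit). -/
lemma infl_mulVec_bv_one (A : Matrix (Fin k) (Fin k) ℂ) (s : ℂ) (a z l : Fin p) (ha : (a : ℕ) = 1) (hz : (z : ℕ) = 0)
    (hl : (l : ℕ) + 1 = p) (x : Fin k → ℂ) :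
    infl p k A s *ᵥ bv p k a x = bv p k z (A *ᵥ x) - s • bv p k l x := by
  rw [infl, Matrix.add_mulVec, Matrix.smul_mulVec, JA_bv_succ p k A a z (by omega), R1_bv_one p k a l ha hl, smul_neg,
    ← sub_eq_add_neg]

/-- `X(e_0 ⊗ x) = s·e_{p−2} ⊗ x` (block `b = p − 2` explicit). -/
lemma infl_mulVec_bv_zero (A : Matrix (Fin k) (Fin k) ℂ) (s : ℂ) (a b : Fin p) (ha : (a : ℕ) = 0) (hb : (b : ℕ) + 2 = p)
    (x : Fin k → ℂ) : infl p k A s *ᵥ bv p k a x = s • bv p k b x := by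
  rw [infl, Matrix.add_mulVec, Matrix.smul_mulVec, JA_bv_zero p k A a ha, R1_bv_zero p k a b ha hb, zero_add]

/-- ★ **THE TWO RETURNS CANCEL: `X²(e_1 ⊗ x) = 0`** (`p ≥ 3`): `X(e_1⊗x) = e_0⊗Ax − s·e_{p−1}⊗x`, and both `X(e_0 ⊗ Ax)` and `s·X(e_{p−1} ⊗ x)`
equal `s·e_{p−2} ⊗ Ax`. -/
lemma infl_mulVec_infl_mulVec_bv_one (hp : 3 ≤ p) (A : Matrix (Fin k) (Fin k) ℂ) (s : ℂ) (a : Fin p) (ha : (a : ℕ) = 1)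
    (x : Fin k → ℂ) : infl p k A s *ᵥ (infl p k A s *ᵥ bv p k a x) = 0 := by
  rw [infl_mulVec_bv_one A s a ⟨0, by omega⟩ ⟨p - 1, by omega⟩ ha rfl (by simp; omega), Matrix.mulVec_sub,
    Matrix.mulVec_smul, infl_mulVec_bv_zero A s _ ⟨p - 2, by omega⟩ rfl (by simp; omega),
    infl_mulVec_bv_two A s _ ⟨p - 2, by omega⟩ (by simp; omega) (by simp; omega), sub_self]

/-- `X^{t+2}(e_a ⊗ x) = 0` for `a = t + 1 ≥ 1` (`p ≥ 3`). -/
lemma infl_pow_mulVec_bv (hp : 3 ≤ p) (A : Matrix (Fin k) (Fin k) ℂ) (s : ℂ) :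
    ∀ (t : ℕ) (a : Fin p), (a : ℕ) = t + 1 → ∀ x : Fin k → ℂ, infl p k A s ^ (t + 2) *ᵥ bv p k a x = 0
  | 0, a, ha, x => by
      rw [pow_two, ← Matrix.mulVec_mulVec]
      exact infl_mulVec_infl_mulVec_bv_one hp A s a ha x
  | t + 1, a, ha, x => by
      rw [pow_succ, ← Matrix.mulVec_mulVec, infl_mulVec_bv_two A s a ⟨t + 1, by omega⟩ (by omega) (by simp; omega)]
      exact infl_pow_mulVec_bv hp A s t _ rfl (A *ᵥ x)

/-- `X^p(e_a ⊗ x) = 0` for every block `a` (`p ≥ 3`). -/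
lemma infl_pow_p_mulVec_bv (hp : 3 ≤ p) (A : Matrix (Fin k) (Fin k) ℂ) (s : ℂ) (a : Fin p) (x : Fin k → ℂ) :
    infl p k A s ^ p *ᵥ bv p k a x = 0 := by
  rcases Nat.eq_zero_or_pos (a : ℕ) with ha | ha
  · -- `a = 0`: one step to `e_{p−2}`, then `p − 1 = (p − 3) + 2` more steps kill it
    have hp1 : infl p k A s ^ p = infl p k A s ^ (p - 3 + 2) * infl p k A s := by
      rw [← pow_succ]; congr 1; omega
    rw [hp1, ← Matrix.mulVec_mulVec, infl_mulVec_bv_zero A s a ⟨p - 2, by omega⟩ ha (by simp; omega), Matrix.mulVec_smul,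
      infl_pow_mulVec_bv hp A s (p - 3) _ (by simp; omega), smul_zero]
  · -- `a ≥ 1`: `X^{a+1}` kills `e_a ⊗ x`, and `a + 1 ≤ p`
    have hap : infl p k A s ^ p = infl p k A s ^ (p - (a : ℕ) - 1) * infl p k A s ^ ((a : ℕ) - 1 + 2) := by
      rw [← pow_add]; congr 1; omega
    rw [hap, ← Matrix.mulVec_mulVec, infl_pow_mulVec_bv hp A s ((a : ℕ) - 1) a (by omega), Matrix.mulVec_zero]

/-- Every vector is the sum of its `p` blocks. -/
lemma eq_sum_bv (v : ι p k → ℂ) : v = ∑ a : Fin p, bv p k a (fun i => v (a, i)) := by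
  ext ⟨b, i⟩
  simp [bv, Finset.sum_apply]

/-- ★ **`U_{p,k}` is a nilpotent space of index `≤ p`**: `X^p = 0` for every `X = J_p ⊗ A + s·(R_p ⊗ 1)`, every `p ≥ 3`. -/
theorem infl_pow_eq_zero (hp : 3 ≤ p) (A : Matrix (Fin k) (Fin k) ℂ) (s : ℂ) : infl p k A s ^ p = 0 := by
  have hv : ∀ v : ι p k → ℂ, infl p k A s ^ p *ᵥ v = 0 := by
    intro v
    rw [eq_sum_bv v, Matrix.mulVec_sum]
    exact Finset.sum_eq_zero fun a _ => infl_pow_p_mulVec_bv hp A s a _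
  ext i j
  have := congrFun (hv (Pi.single j 1)) i
  rwa [Matrix.mulVec_single_one] at this

/-- **`U_{p,k}` is a nilpotent space** (`p ≥ 3`). -/
theorem inflSpace_nilpotent (hp : 3 ≤ p) : ∀ X ∈ inflSpace p k, IsNilpotent X := by
  intro X hX
  obtain ⟨A, s, rfl⟩ := (mem_inflSpace p k).1 hX
  exact ⟨p, infl_pow_eq_zero hp A s⟩

/-! ## §5 Irreducibility -/

/-- Powers of the shift on block vectors, target block explicit: `(J_p⊗1)^t (e_a ⊗ x) = e_b ⊗ x` for `b + t = a`. -/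
lemma J1_pow_mulVec_bv_of_le : ∀ (t : ℕ) (a b : Fin p), (b : ℕ) + t = a → ∀ x : Fin k → ℂ,
    (Jp p ⊗ₖ (1 : Matrix (Fin k) (Fin k) ℂ)) ^ t *ᵥ bv p k a x = bv p k b x
  | 0, a, b, hb, x => by
      have : b = a := Fin.ext (by omega)
      rw [pow_zero, Matrix.one_mulVec, this]
  | t + 1, a, b, hb, x => by
      rw [pow_succ, ← Matrix.mulVec_mulVec, JA_bv_succ p k 1 a ⟨(a : ℕ) - 1, by omega⟩ (by simp; omega), Matrix.one_mulVec]
      exact J1_pow_mulVec_bv_of_le t _ b (by simp; omega) x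

/-- … and `= 0` for `t > a`. -/
lemma J1_pow_mulVec_bv_of_lt : ∀ (t : ℕ) (a : Fin p), (a : ℕ) < t → ∀ x : Fin k → ℂ,
    (Jp p ⊗ₖ (1 : Matrix (Fin k) (Fin k) ℂ)) ^ t *ᵥ bv p k a x = 0
  | 0, a, ha, x => absurd ha (Nat.not_lt_zero _)
  | t + 1, a, ha, x => by
      rw [pow_succ, ← Matrix.mulVec_mulVec]
      rcases Nat.eq_zero_or_pos (a : ℕ) with h0 | h0
      · rw [JA_bv_zero p k 1 a h0, Matrix.mulVec_zero]
      · rw [JA_bv_succ p k 1 a ⟨(a : ℕ) - 1, by omega⟩ (by simp; omega), Matrix.one_mulVec]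
        exact J1_pow_mulVec_bv_of_lt t _ (by simp; omega) x

/-- ★ **`U_{p,k}` is irreducible** on `ℂ^p ⊗ ℂ^k` (`p ≥ 3`; for `k = 0` the space `ℂ^p ⊗ ℂ^0 = 0` and the statement is trivial). -/
theorem inflSpace_irreducible (hp : 3 ≤ p) :
    ∀ V : Submodule ℂ (ι p k → ℂ), (∀ X ∈ inflSpace p k, ∀ x ∈ V, X *ᵥ x ∈ V) → V = ⊥ ∨ V = ⊤ := by
  classical
  intro V hV
  by_cases hbot : V = ⊥
  · exact Or.inl hbot
  right
  obtain ⟨v, hvV, hv0⟩ : ∃ v ∈ V, v ≠ 0 := by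
    by_contra h
    push Not at h
    exact hbot ((Submodule.eq_bot_iff V).2 h)
  -- the letters act on `V`
  have hJ1 : ∀ x ∈ V, (Jp p ⊗ₖ (1 : Matrix (Fin k) (Fin k) ℂ)) *ᵥ x ∈ V := fun x hx => hV _ (JA_mem p k 1) x hx
  have hJ1pow : ∀ (t : ℕ), ∀ x ∈ V, (Jp p ⊗ₖ (1 : Matrix (Fin k) (Fin k) ℂ)) ^ t *ᵥ x ∈ V := by
    intro t
    induction t with
    | zero => intro x hx; simpa using hx
    | succ t ih => intro x hx; rw [pow_succ, ← Matrix.mulVec_mulVec]; exact ih _ (hJ1 x hx)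
  have hJA : ∀ A, ∀ x ∈ V, (Jp p ⊗ₖ A) *ᵥ x ∈ V := fun A x hx => hV _ (JA_mem p k A) x hx
  have hR : ∀ x ∈ V, (Rp p ⊗ₖ (1 : Matrix (Fin k) (Fin k) ℂ)) *ᵥ x ∈ V := fun x hx => hV _ (R1_mem p k) x hx
  -- the distinguished blocks
  set z : Fin p := ⟨0, by omega⟩ with hz
  -- Step 1: some `e_0 ⊗ w ∈ V` with `w ≠ 0` — shift the TOP non-zero block of `v` down to block `0`
  set y : Fin p → (Fin k → ℂ) := fun a i => v (a, i) with hy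
  have hv : v = ∑ a : Fin p, bv p k a (y a) := eq_sum_bv v
  have hS : (Finset.univ.filter fun a : Fin p => y a ≠ 0).Nonempty := by
    by_contra h
    rw [Finset.not_nonempty_iff_eq_empty, Finset.filter_eq_empty_iff] at h
    apply hv0
    rw [hv]
    refine Finset.sum_eq_zero fun a _ => ?_
    have : y a = 0 := by simpa using h (Finset.mem_univ a)
    rw [this, bv_zero]
  obtain ⟨a₀, ha₀S, hmax⟩ := Finset.exists_max_image _ (fun a : Fin p => (a : ℕ)) hS
  have ha₀ : y a₀ ≠ 0 := (Finset.mem_filter.mp ha₀S).2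
  have hshift : (Jp p ⊗ₖ (1 : Matrix (Fin k) (Fin k) ℂ)) ^ (a₀ : ℕ) *ᵥ v = bv p k z (y a₀) := by
    rw [hv, Matrix.mulVec_sum, Finset.sum_eq_single a₀]
    · exact J1_pow_mulVec_bv_of_le _ a₀ z (by simp [hz]) _
    · intro a _ hne
      by_cases h : (a₀ : ℕ) ≤ (a : ℕ)
      · have hya : y a = 0 := by
          by_contra hya
          have := hmax a (Finset.mem_filter.mpr ⟨Finset.mem_univ a, hya⟩)
          exact hne (Fin.ext (le_antisymm this h))
        rw [hya, bv_zero, Matrix.mulVec_zero]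
      · exact J1_pow_mulVec_bv_of_lt _ a (by omega) _
    · intro h; exact absurd (Finset.mem_univ a₀) h
  have hwV : bv p k z (y a₀) ∈ V := by rw [← hshift]; exact hJ1pow _ v hvV
  set w := y a₀ with hw
  -- Step 2: `e_0 ⊗ (A w) ∈ V` for every `A`: return with `R ⊗ 1`, move with `J ⊗ A`, shift with `(J ⊗ 1)^{p−3}`
  have hstep : ∀ A : Matrix (Fin k) (Fin k) ℂ, bv p k z (A *ᵥ w) ∈ V := by
    intro A
    have h1 : bv p k ⟨p - 2, by omega⟩ w ∈ V := by
      have := hR _ hwV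
      rwa [R1_bv_zero p k z ⟨p - 2, by omega⟩ (by simp [hz]) (by simp; omega)] at this
    have h2 : bv p k ⟨p - 3, by omega⟩ (A *ᵥ w) ∈ V := by
      have := hJA A _ h1
      rwa [JA_bv_succ p k A _ ⟨p - 3, by omega⟩ (by simp; omega)] at this
    have h3 := hJ1pow (p - 3) _ h2
    rwa [J1_pow_mulVec_bv_of_le (p - 3) _ z (by simp [hz]) _] at h3
  -- Step 3: `e_0 ⊗ x ∈ V` for every `x`
  have h0 : ∀ x : Fin k → ℂ, bv p k z x ∈ V := by
    intro x
    obtain ⟨j, hj⟩ : ∃ j, w j ≠ 0 := by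
      by_contra h; push Not at h; exact ha₀ (funext h)
    let A : Matrix (Fin k) (Fin k) ℂ := fun i l => if l = j then x i / w j else 0
    have hA : A *ᵥ w = x := by
      ext i
      simp only [Matrix.mulVec, dotProduct, A, ite_mul, zero_mul, Finset.sum_ite_eq', Finset.mem_univ, if_true]
      field_simp
    simpa [hA] using hstep A
  -- Step 4: all blocks
  have hpm2 : ∀ x : Fin k → ℂ, bv p k ⟨p - 2, by omega⟩ x ∈ V := fun x => by
    have := hR _ (h0 x)
    rwa [R1_bv_zero p k z ⟨p - 2, by omega⟩ (by simp [hz]) (by simp; omega)] at this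
  have hle : ∀ (a : Fin p), (a : ℕ) ≤ p - 2 → ∀ x : Fin k → ℂ, bv p k a x ∈ V := by
    intro a ha x
    have := hJ1pow (p - 2 - (a : ℕ)) _ (hpm2 x)
    rwa [J1_pow_mulVec_bv_of_le (p - 2 - (a : ℕ)) _ a (by simp; omega) _] at this
  have hpm1 : ∀ x : Fin k → ℂ, bv p k ⟨p - 1, by omega⟩ x ∈ V := fun x => by
    have := hR _ (hle ⟨1, by omega⟩ (by simp; omega) x)
    rw [R1_bv_one p k _ ⟨p - 1, by omega⟩ rfl (by simp; omega)] at this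
    simpa using V.neg_mem this
  have hall : ∀ (a : Fin p) (x : Fin k → ℂ), bv p k a x ∈ V := by
    intro a x
    by_cases ha : (a : ℕ) ≤ p - 2
    · exact hle a ha x
    · have : a = ⟨p - 1, by omega⟩ := Fin.ext (by simp; omega)
      rw [this]; exact hpm1 x
  -- conclusion
  rw [eq_top_iff]
  intro u _
  rw [eq_sum_bv u]
  exact V.sum_mem fun a _ => hall a _

/-! ## §6 Dimension count -/

/-- The `M_k`-part (block `(0,1)`) as a linear map (`p ≥ 2`). -/
def blockPart (hp : 2 ≤ p) : Matrix (ι p k) (ι p k) ℂ →ₗ[ℂ] Matrix (Fin k) (Fin k) ℂ where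
  toFun X := Matrix.of fun i l => X (⟨0, by omega⟩, i) (⟨1, by omega⟩, l)
  map_add' X Y := by ext i l; simp
  map_smul' c X := by ext i l; simp

/-- The `s`-part (entry `((p−2,i₀),(0,i₀))`) as a linear map (`p ≥ 2`). -/
def scalarPart (hp : 2 ≤ p) (i₀ : Fin k) : Matrix (ι p k) (ι p k) ℂ →ₗ[ℂ] ℂ where
  toFun X := X (⟨p - 2, by omega⟩, i₀) (⟨0, by omega⟩, i₀)
  map_add' X Y := by simp
  map_smul' c X := by simp

/-- The block part of `J_p ⊗ A + s·(R_p ⊗ 1)` is `A` (`p ≥ 3`). -/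
lemma blockPart_infl (hp : 3 ≤ p) (A : Matrix (Fin k) (Fin k) ℂ) (s : ℂ) :
    blockPart (k := k) (show 2 ≤ p by omega) (infl p k A s) = A := by
  ext i l
  have h1 : (1 : ℕ) ≠ p := by omega
  simp [blockPart, infl, Matrix.kroneckerMap_apply, Jp, Rp, h1]

/-- The scalar part of `J_p ⊗ A + s·(R_p ⊗ 1)` is `s` (`p ≥ 3`). -/
lemma scalarPart_infl (hp : 3 ≤ p) (i₀ : Fin k) (A : Matrix (Fin k) (Fin k) ℂ) (s : ℂ) :
    scalarPart (k := k) (show 2 ≤ p by omega) i₀ (infl p k A s) = s := by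
  have h2 : p - 2 + 2 = p := by omega
  simp [scalarPart, infl, Matrix.kroneckerMap_apply, Jp, Rp, h2]

/-- The inflation is injective (`p ≥ 3`, `k ≥ 1`). -/
lemma inflLin_injective (hp : 3 ≤ p) (hk : 1 ≤ k) : Function.Injective (inflLin p k) := by
  intro q q' h
  have i₀ : Fin k := ⟨0, hk⟩
  have hA : q.1 = q'.1 := by
    have := congrArg (blockPart (k := k) (show 2 ≤ p by omega)) h
    simpa [inflLin, blockPart_infl hp] using this
  have hs : q.2 = q'.2 := by
    have := congrArg (scalarPart (k := k) (show 2 ≤ p by omega) i₀) h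
    simpa [inflLin, scalarPart_infl hp] using this
  exact Prod.ext hA hs

/-- `dim U_{p,k} = k² + 1` (`p ≥ 3`, `k ≥ 1`). -/
lemma finrank_inflSpace (hp : 3 ≤ p) (hk : 1 ≤ k) : Module.finrank ℂ (inflSpace p k) = k * k + 1 := by
  rw [inflSpace, LinearMap.finrank_range_of_inj (inflLin_injective hp hk)]
  simp [Module.finrank_prod, Module.finrank_matrix]

end Summit.ValiantsHypothesis.ValiantsHypothesis.Theorems.DualUnipotentThreeHalvesNegative.InflatedReturnsGeneral
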